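import Mathlib.LinearAlgebra.Dimension.RankNullity
import Mathlib.LinearAlgebra.Dimension.Localization
import Mathlib.GroupTheory.OrderOfElement
import Summits.BirchSwinnertonDyer.BirchSwinnertonDyer.Theorems.ClassRecordThreeShimuraKolyvaginOrderBoundAtThreeTransport
import HarnessLib

/-!
# Crux `ShimuraKolyvaginOrderBoundAtThreeSurj` (item stmt-BirchSwinnertonDyer-19899), stub T
# `stub_orderBoundSurj_transportAtThree` — BY NAME, FACT-FREE

Cell `bsd-stepL` (run/shared/lean/pub/bsd-stepL/), seat `bsd-stepL-shim-p2` (gen 4). The crux item 19899 (D7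
restatement of 19616; RESIDUAL on routes `route-BirchSwinnertonDyer-ClassRecordThree` (K2@3) and
`route-BirchSwinnertonDyer-KolyvaginRoadThree` (KOLY)) carries the registered skeleton v3 (planner g27,
sha16 b5621f5fb3bef0cc, `Cruxes/ShimuraKolyvaginOrderBoundAtThreeSurj/Lines/birth.lean`): a PROOF CUT
`_of : H → T → crux` with H = `stub_orderBoundSurj_heegnerPointAtThree` (ONE Gross–Zagier-displayed point with
Kolyvagin's order bound — the NOT-PRINTED residual) and T = `stub_orderBoundSurj_transportAtThree` (the
rank-one TRANSPORT of the bound from one displayed non-torsion point to every displayed point).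

THIS FILE proves T with its REGISTERED SIGNATURE VERBATIM and NO named-fact hypothesis. The skeleton's docstring
expected T to stay open in the kernel «until Gross–Zagier–Kolyvagin over `ℚ` and modularity are proved», because
seat shim3a's p468392 (`…Theorems.ShimuraKolyvaginTransport.card_sha_primaryComponent_le_of_two_displays`) does the
bookkeeping in RANK ONE and gets rank one from `L′(E/K,1) ≠ 0` through those two facts. The observation here:
rank one is not needed. Split on `r := rank_ℤ E(K)` (Mordell–Weil is the tree THEOREM
`WeierstrassCurve.module_finite_point_holds`):
* `r = 1`: p468392's transport verbatim;
* `r ≠ 1`: `P` is non-torsion, so `r ≥ 1`, so `r ≥ 2`, and then EVERY cyclic subgroup `ℤQ ≤ E(K)` with `Q`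
  non-torsion has infinite index — `(AddSubgroup.zmultiples Q).index = 0` (if the index `n` were positive,
  `n • E(K) ⊆ ℤP` and rank–nullity over `ℤ` would force `r ≤ 1`). Both `ord_p [E(K):ℤP₁]` and
  `ord_p [E(K):ℤP]` therefore read `ord_p 0 = 0`, and the hypothesis «bound at `P₁` when `P₁` is non-torsion»
  (it is: the two displays share the non-zero constant `8π²(f,f)/((w_K/2)²√|d_K|)` — Petersson positivity
  `peterssonProduct_self_pos_holds` — and `ĥ(P) ≠ 0`) IS the bound at `P`.
So the index currency of the crux degenerates off rank one exactly as the ∀-form does, and T is a theorem of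
the kernel. With T landed, skeleton v3 reduces the crux to H ALONE (the honest residual; nothing here claims H).

HONEST FRAMING. Theorems only; no `def`, no named fact, no `sorry`; axioms standard. Closes nothing by itself
(T7): `--supports stmt-BirchSwinnertonDyer-19899`, stub T by registered NAME + signature. PARTITION: O2@3 (B10) ×
A1 ∕ (ram) × crux 19899 — types-the-object-of (a registered stub → kernel theorem).

## Contents
* `index_zmultiples_eq_zero_of_finrank_ne_one` — f.g. abelian group of `ℤ`-rank `≠ 1`, `P` non-torsion ⇒
  `[G : ℤP] = 0` (infinite index), by rank–nullity over `ℤ` (`IsDomain.hasRankNullity`).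
* `not_isOfFinAddOrder_of_two_displays` — two displays with a common non-zero constant and `P` non-torsion ⇒
  `P₁` non-torsion (`canonicalHeight_eq_zero_iff_holds`).
* `displayConstant_ne_zero` — `8π²(f,f)/((w_K/2)²√|d_K|) ≠ 0` (p468392 §4, isolated).
* `card_sha_primaryComponent_le_of_two_displays_anyRank` — p468392's transport WITHOUT the rank-one hypothesis.
* `stub_orderBoundSurj_transportAtThree` — the registered stub, verbatim, fact-free.

References: [SilvermanAEC2009] Thm. VIII.6.7, VIII.9; [Darmon2004] §3.9 (context only); D-AUDIT-19526c4 §III;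
HOME/plan/D7/skel/Lines-birth-19899-v3.lean.
-/

noncomputable section

open scoped Classical

set_option linter.dupNamespace false

namespace Summit.BirchSwinnertonDyer.BirchSwinnertonDyer.Theorems.ShimuraKolyvaginSurjTransport

open WeierstrassCurve NumberField Literature.NumberTheory.EllipticCurves
  Literature.NumberTheory.EllipticCurves.ModularForms
  Literature.NumberTheory.Automorphic CongruenceSubgroup
  Summit.BirchSwinnertonDyer.BirchSwinnertonDyer.Theorems.ShimuraKolyvaginTransport

/-! ### §1. Off rank one every non-torsion cyclic subgroup has infinite index -/

/-- **Infinite index off rank one.** In a finitely generated abelian group `G` of `ℤ`-rank `≠ 1`, a non-torsion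
element `P` generates a subgroup of INFINITE index, i.e. `(AddSubgroup.zmultiples P).index = 0` (Mathlib's
convention for infinite index). Proof: `P` non-torsion forces `rank G ≥ 1` (`Module.finrank_eq_zero_iff`), so
`rank G ≥ 2`; if the index `n` were positive then `n • x ∈ ℤP` for every `x` (`AddSubgroup.nsmul_index_mem`), so
the range of multiplication by `n` has rank `≤ 1` and its kernel (killed by `n`) rank `0`, and rank–nullity over
`ℤ` (`Submodule.finrank_quotient_add_finrank`, `IsDomain.hasRankNullity`) gives `rank G ≤ 1`. [folklore]
[cite: SilvermanAEC2009, VIII.6 (structure of finitely generated abelian groups)] -/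
theorem index_zmultiples_eq_zero_of_finrank_ne_one {G : Type*} [AddCommGroup G] [Module.Finite ℤ G]
    {P : G} (hP : ¬ IsOfFinAddOrder P) (h1 : Module.finrank ℤ G ≠ 1) :
    (AddSubgroup.zmultiples P).index = 0 := by
  by_contra hn
  set n : ℕ := (AddSubgroup.zmultiples P).index with hn_def
  -- multiplication by `n` lands in `ℤ ∙ P`
  let ψ : G →ₗ[ℤ] G := (n : ℤ) • LinearMap.id
  have hψ : ∀ x, ψ x = (n : ℤ) • x := fun x ↦ rfl
  have hrange : LinearMap.range ψ ≤ Submodule.span ℤ {P} := by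
    rintro _ ⟨x, rfl⟩
    have hx : n • x ∈ AddSubgroup.zmultiples P := (AddSubgroup.zmultiples P).nsmul_index_mem x
    obtain ⟨k, hk⟩ := AddSubgroup.mem_zmultiples_iff.mp hx
    refine Submodule.mem_span_singleton.mpr ⟨k, ?_⟩
    rw [hψ, natCast_zsmul]
    exact hk
  have hker : Module.finrank ℤ (LinearMap.ker ψ) = 0 := by
    refine Module.finrank_eq_zero_iff.mpr fun x ↦ ⟨(n : ℤ), by exact_mod_cast hn, ?_⟩
    have hx : ψ x.1 = 0 := x.2
    rw [hψ] at hx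
    exact Subtype.ext hx
  have hr1 : Module.finrank ℤ (LinearMap.range ψ) ≤ 1 := by
    refine (Submodule.finrank_mono hrange).trans ?_
    have h := finrank_span_le_card (R := ℤ) ({P} : Set G)
    simpa using h
  have hrn : Module.finrank ℤ (LinearMap.range ψ) + Module.finrank ℤ (LinearMap.ker ψ) =
      Module.finrank ℤ G := by
    rw [← ψ.quotKerEquivRange.finrank_eq]
    exact Submodule.finrank_quotient_add_finrank _
  have hpos : Module.finrank ℤ G ≠ 0 := by
    intro h0
    obtain ⟨a, ha0, haP⟩ := (Module.finrank_eq_zero_iff).mp h0 P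
    exact hP (isOfFinAddOrder_iff_zsmul_eq_zero.mpr ⟨a, ha0, haP⟩)
  omega

/-! ### §2. Display bookkeeping -/

/-- **Non-torsion transfers along two displays with a common non-zero constant.** If
`L = c·ĥ(P₁)/degS₁ = c·ĥ(P)/degS` with `c ≠ 0`, `degS₁, degS ≥ 1` and `P` non-torsion (`ĥ(P) ≠ 0`,
`canonicalHeight_eq_zero_iff_holds`), then `ĥ(P₁) ≠ 0`, so `P₁` is non-torsion. [folklore]
[cite: SilvermanAEC2009, Thm. VIII.9.3] -/
theorem not_isOfFinAddOrder_of_two_displays (W : WeierstrassCurve ℚ) [W.IsElliptic]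
    (K : Type) [Field K] [NumberField K] {c L : ℂ} (hc : c ≠ 0)
    {P₁ P : (W.baseChange K).toAffine.Point} {degS₁ degS : ℕ} (h0₁ : 0 < degS₁) (h0 : 0 < degS)
    (hd₁ : L = c * ((P₁.canonicalHeight : ℂ) / (degS₁ : ℂ)))
    (hd : L = c * ((P.canonicalHeight : ℂ) / (degS : ℂ)))
    (hnt : ¬ IsOfFinAddOrder P) : ¬ IsOfFinAddOrder P₁ := by
  haveI hEK : (W.baseChange K).IsElliptic := by rw [WeierstrassCurve.baseChange]; infer_instance
  have hdeg₁ : (degS₁ : ℂ) ≠ 0 := by exact_mod_cast h0₁.ne'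
  have hdeg : (degS : ℂ) ≠ 0 := by exact_mod_cast h0.ne'
  have hq : (P₁.canonicalHeight : ℂ) / (degS₁ : ℂ) = (P.canonicalHeight : ℂ) / (degS : ℂ) :=
    mul_left_cancel₀ hc (hd₁.symm.trans hd)
  rw [div_eq_div_iff hdeg₁ hdeg] at hq
  have hreal : P₁.canonicalHeight * (degS : ℝ) = P.canonicalHeight * (degS₁ : ℝ) := by exact_mod_cast hq
  have hhP : P.canonicalHeight ≠ 0 := fun h ↦
    hnt ((WeierstrassCurve.Affine.Point.canonicalHeight_eq_zero_iff_holds P).mp h)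
  intro htor
  have h1 : P₁.canonicalHeight = 0 :=
    (WeierstrassCurve.Affine.Point.canonicalHeight_eq_zero_iff_holds P₁).mpr htor
  rw [h1, zero_mul] at hreal
  have hdS₁ : (degS₁ : ℝ) ≠ 0 := by exact_mod_cast h0₁.ne'
  rcases mul_eq_zero.mp hreal.symm with h | h
  · exact hhP h
  · exact hdS₁ h

/-- **The Gross–Zagier display constant is non-zero**: `8π²(f,f)/((w_K/2)²√|d_K|) ≠ 0` for the newform `f`
of a modular parametrization datum (`f ≠ 0`, Petersson positivity `peterssonProduct_self_pos_holds`,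
`w_K ≥ 1`, `d_K ≠ 0`). Isolated from p468392 §4. [folklore] -/
theorem displayConstant_ne_zero {W : WeierstrassCurve ℚ} {N : ℕ} [NeZero N]
    (Dt : ModularParametrizationData W N) (K : Type) [Field K] [NumberField K] :
    8 * (Real.pi : ℂ) ^ 2 * peterssonProduct (Gamma0 N) 2 Dt.f Dt.f /
      ((((Units.torsionOrder K : ℝ) / 2) ^ 2 * √|(NumberField.discr K : ℝ)| : ℝ) : ℂ) ≠ 0 := by
  have hf : Dt.f ≠ 0 := Dt.isNewformOf.1.ne_zero
  have hpet : peterssonProduct (Gamma0 N) 2 Dt.f Dt.f ≠ 0 := by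
    intro h0
    have hpos := peterssonProduct_self_pos_holds (Gamma0 N) 2 hf
    rw [h0] at hpos
    simp at hpos
  have hden : ((((Units.torsionOrder K : ℝ) / 2) ^ 2 * √|(NumberField.discr K : ℝ)| : ℝ) : ℂ) ≠ 0 := by
    have hu : (0 : ℝ) < Units.torsionOrder K := by exact_mod_cast Units.torsionOrder_pos K
    have hd : (0 : ℝ) < |(NumberField.discr K : ℝ)| :=
      abs_pos.mpr (by exact_mod_cast NumberField.discr_ne_zero K)
    have hsq : (0 : ℝ) < √|(NumberField.discr K : ℝ)| := Real.sqrt_pos.mpr hd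
    have hpos : (0 : ℝ) < ((Units.torsionOrder K : ℝ) / 2) ^ 2 * √|(NumberField.discr K : ℝ)| := by
      positivity
    exact_mod_cast hpos.ne'
  have hπ : (Real.pi : ℂ) ≠ 0 := by exact_mod_cast Real.pi_ne_zero
  exact div_ne_zero (mul_ne_zero (mul_ne_zero (by norm_num) (pow_ne_zero _ hπ)) hpet) hden

/-! ### §3. The transport in EVERY rank -/

/-- **Transport of Kolyvagin's order bound between displayed points — no rank hypothesis, no named fact.**
Two displays `L = c·ĥ(P₁)/degS₁ = c·ĥ(P)/degS` with `c ≠ 0`, `degS₁, degS ≥ 1`, `ord_p degS₁ = ord_p degS`,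
`P` non-torsion, and the bound `#Ш(E/K)[p^∞] ≤ p^{2·ord_p[E(K):ℤP₁]}` available when `P₁` is non-torsion,
give the bound at `P`. Rank one (`rank_ℤ E(K) = 1`): p468392's `card_sha_primaryComponent_le_of_two_displays`.
Otherwise (`E(K)` is finitely generated — Mordell–Weil, tree theorem `module_finite_point_holds` — of rank `≥ 2`
since `P` is non-torsion): both indices are infinite, `[E(K):ℤP₁] = [E(K):ℤP] = 0` as naturals
(`index_zmultiples_eq_zero_of_finrank_ne_one`), so the bound at `P₁` (non-torsion by
`not_isOfFinAddOrder_of_two_displays`) is literally the bound at `P`. [folklore]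
[cite: SilvermanAEC2009, Thm. VIII.6.7 and Thm. VIII.9.3] -/
theorem card_sha_primaryComponent_le_of_two_displays_anyRank (W : WeierstrassCurve ℚ) [W.IsElliptic]
    (K : Type) [Field K] [NumberField K] {p : ℕ} (hp : p.Prime) {c L : ℂ} (hc : c ≠ 0)
    {P₁ P : (W.baseChange K).toAffine.Point} {degS₁ degS : ℕ} (h0₁ : 0 < degS₁) (h0 : 0 < degS)
    (hv : padicValNat p degS₁ = padicValNat p degS)
    (hd₁ : L = c * ((P₁.canonicalHeight : ℂ) / (degS₁ : ℂ)))
    (hd : L = c * ((P.canonicalHeight : ℂ) / (degS : ℂ)))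
    (hnt : ¬ IsOfFinAddOrder P)
    (hB₁ : ¬ IsOfFinAddOrder P₁ →
      Nat.card (AddCommGroup.primaryComponent (W.baseChange K).sha p) ≤
        p ^ (2 * padicValNat p (AddSubgroup.zmultiples P₁).index)) :
    Nat.card (AddCommGroup.primaryComponent (W.baseChange K).sha p) ≤
      p ^ (2 * padicValNat p (AddSubgroup.zmultiples P).index) := by
  haveI hEK : (W.baseChange K).IsElliptic := by rw [WeierstrassCurve.baseChange]; infer_instance
  rcases eq_or_ne (W.baseChange K).mordellWeilRank 1 with hrk | hrk
  · exact card_sha_primaryComponent_le_of_two_displays W K hp hrk hc h0₁ h0 hv hd₁ hd hnt hB₁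
  · haveI : Module.Finite ℤ (W.baseChange K).toAffine.Point := (W.baseChange K).module_finite_point_holds
    have h1 : Module.finrank ℤ (W.baseChange K).toAffine.Point ≠ 1 := hrk
    have hnt₁ : ¬ IsOfFinAddOrder P₁ := not_isOfFinAddOrder_of_two_displays W K hc h0₁ h0 hd₁ hd hnt
    have hB := hB₁ hnt₁
    rw [index_zmultiples_eq_zero_of_finrank_ne_one hnt₁ h1] at hB
    rw [index_zmultiples_eq_zero_of_finrank_ne_one hnt h1]
    exact hB

/-! ### §4. The registered stub T, verbatim, fact-free -/

/-- **Stub T `stub_orderBoundSurj_transportAtThree` of crux 19899 (skeleton v3 b5621f5f) — REGISTERED SIGNATURE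
VERBATIM, NO named-fact hypothesis.** On the crux's binder list (all of it idle here except the two displays,
`0 < degS₁`, `0 < degS`, the two `ord_p degS = ord_p deg P₀` clauses and `P` non-torsion): two Gross–Zagier
displays with the same `ord₃ degS`, the first point carrying Kolyvagin's order bound when non-torsion, force
the bound at the second (non-torsion) point — by `card_sha_primaryComponent_le_of_two_displays_anyRank` with the
non-zero display constant `displayConstant_ne_zero`. The skeleton's `_of : H → T → crux` then leaves the crux
resting on H (`stub_orderBoundSurj_heegnerPointAtThree`, NOT PRINTED at `3 ∣ N⁺`, `N⁻ > 1`) alone.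
[folklore] [cite: SilvermanAEC2009, Thm. VIII.6.7 and Thm. VIII.9.3] -/
theorem stub_orderBoundSurj_transportAtThree :
  ∀ (W : WeierstrassCurve ℚ) [W.IsElliptic] [W.IsGloballyMinimal] (p : ℕ) [Fact p.Prime]
    (N : ℕ) [NeZero N] (K : Type) [Field K] [NumberField K] (S : Finset ℕ)
    (Dt : ModularParametrizationData W N)
    (X : ShimuraCurveData (∏ q ∈ S, q) (N / ∏ q ∈ S, q))
    (W' : WeierstrassCurve ℚ) [W'.IsElliptic] (P₀ : ShimuraParametrizationData X W'),
    W.conductorNorm ℤ = N → Literature.NumberTheory.EllipticCurves.Rank1Residual.Surj W 3 →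
    p ≠ 2 → W.HasIrreducibleModPGaloisRep p →
    IsImaginaryQuadratic K → Even S.card →
    (∀ ℓ ∈ S, ℓ.Prime ∧ ℓ ∣ N ∧ ¬ ℓ ^ 2 ∣ N ∧
      ((Ideal.span {(ℓ : ℤ)}).primesOver (𝓞 K)).ncard = 1 ∧ ¬ (ℓ : ℤ) ∣ NumberField.discr K) →
    (∀ ℓ : ℕ, ℓ.Prime → ℓ ∣ N → ℓ ∉ S → ((Ideal.span {(ℓ : ℤ)}).primesOver (𝓞 K)).ncard = 2) →
    ((Ideal.span {(p : ℤ)}).primesOver (𝓞 K)).ncard = 2 →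
    P₀.IsMinimalFor W →
    p ∣ N → p = 3 →
    ∀ (P₁ : (W.baseChange K).toAffine.Point) (degS₁ : ℕ) (P : (W.baseChange K).toAffine.Point) (degS : ℕ),
      0 < degS₁ → 0 < degS →
      padicValNat p degS₁ = padicValNat p P₀.deg → padicValNat p degS = padicValNat p P₀.deg →
      LDerivEK W K =
          8 * (Real.pi : ℂ) ^ 2 * peterssonProduct (Gamma0 N) 2 Dt.f Dt.f /
              ((((Units.torsionOrder K : ℝ) / 2) ^ 2 * √|(NumberField.discr K : ℝ)| : ℝ) : ℂ) *
            ((P₁.canonicalHeight : ℂ) / (degS₁ : ℂ)) →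
      LDerivEK W K =
          8 * (Real.pi : ℂ) ^ 2 * peterssonProduct (Gamma0 N) 2 Dt.f Dt.f /
              ((((Units.torsionOrder K : ℝ) / 2) ^ 2 * √|(NumberField.discr K : ℝ)| : ℝ) : ℂ) *
            ((P.canonicalHeight : ℂ) / (degS : ℂ)) →
      (¬ IsOfFinAddOrder P₁ →
        Nat.card (AddCommGroup.primaryComponent (W.baseChange K).sha p) ≤
            p ^ (2 * padicValNat p (AddSubgroup.zmultiples P₁).index)) →
      ¬ IsOfFinAddOrder P →
        Nat.card (AddCommGroup.primaryComponent (W.baseChange K).sha p) ≤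
            p ^ (2 * padicValNat p (AddSubgroup.zmultiples P).index) := by
  intro W _ _ p _ N _ K _ _ S Dt X W' _ P₀ _hN _hsurj _hp2 _hirr _hK _hS _hin _hsp _hps _hmin _hpN _hp3
    P₁ degS₁ P degS h0₁ h0 hv₁ hv hdisp₁ hdisp hB₁ hPnt
  exact card_sha_primaryComponent_le_of_two_displays_anyRank W K (Fact.out) (displayConstant_ne_zero Dt K)
    h0₁ h0 (hv₁.trans hv.symm) hdisp₁ hdisp hPnt hB₁

end Summit.BirchSwinnertonDyer.BirchSwinnertonDyer.Theorems.ShimuraKolyvaginSurjTransport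

end
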